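import Mathlib
import HarnessLib
import Summits.NavierStokesRegularity.NavierStokesRegularity.Theorems.PoloidalWindowDoorLrcModEntireJetCertFast
import Summits.NavierStokesRegularity.NavierStokesRegularity.Theorems.PoloidalWindowDoorLrcModEntireTHCert

/-!
# Route `PoloidalWindowDoor`, item `LrcModEntire` (stmt-NavierStokesRegularity-20428) — `stub_localTHEmpty` from FAST and from CHUNKED
# certificates (wiring, part 3)

Cell ns-regularity-ideate, seat ns-poloidal-K2-p3 gen 7 (lead of item 20428; `--supports stmt-NavierStokesRegularity-20428`).
Kernel calibration (this seat, `decide +kernel` on the farm): one total-derivative step of an 80-term law over 66 letters costs ≈ 90 s with the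
v1 derivative; three steps in ONE `decide` exceed the budget.  Hence two additions to `…THCert.stub_localTHEmpty_of_checkTree`:

* `thLocalDatum` — the stub's analytic data `(u, μ, A, U, p₀)` packaged ONCE as a `LocalDatum L.length (tableOf L) (maskOf L) dirVec (thHyps L) (thPins L)`;
* `ev_eq_zero_of_certCheckF`, **`localDatum_extend`** — a fast masked certificate whose `k`-th law is (syntactically) `T` proves that `T`
  vanishes on `U`, so `T` may be APPENDED TO THE HYPOTHESIS LAWS: a long certificate is CHUNKED into files, each a single
  `theorem chunkᵢ : certCheckF n S M (thHyps L ++ [T₁,…,Tᵢ₋₁]) certᵢ kᵢ Tᵢ = true := by decide +kernel`, folded by `localDatum_extend`;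
* `not_localDatum_thPins_of_checkTreeF` / **`stub_localTHEmpty_of_checkTreeF`** — the fast tree checker closes the stub (one-shot form), and the
  generated assembly of a chunked certificate ends with `not_localDatum_of_checkTreeF t _ _ ht (localDatum_extend (… (thLocalDatum …) …))`.

WHAT THIS IS NOT: not a claim about Navier–Stokes and not a certificate (none exists yet) — the kernel path, chunkable (bears_on LADDER-NS N0,
item 20428 `stub_localTHEmpty`). [folklore]
-/

noncomputable section

-- the summit and its single sub-problem share the name (CONVENTIONS §1), as in every Theorems file
set_option linter.dupNamespace false

namespace Summit.NavierStokesRegularity.NavierStokesRegularity.Theorems.PoloidalWindowDoorLrcModEntireTHCertFast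

open _root_.Topology _root_.Filter Set Function
open scoped InnerProductSpace Laplacian
open Literature.Analysis.ValidatedNumerics Literature.Analysis.ValidatedNumerics.QMvPoly
open Summit.NavierStokesRegularity.NavierStokesRegularity.Theorems.PoloidalWindowDoorLrcModEntireJetCertDefs
open Summit.NavierStokesRegularity.NavierStokesRegularity.Theorems.PoloidalWindowDoorLrcModEntireJetCertMasked
open Summit.NavierStokesRegularity.NavierStokesRegularity.Theorems.PoloidalWindowDoorLrcModEntireJetCertTree
open Summit.NavierStokesRegularity.NavierStokesRegularity.Theorems.PoloidalWindowDoorLrcModEntireJetCertFast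
open Summit.NavierStokesRegularity.NavierStokesRegularity.Theorems.PoloidalWindowDoorLrcModEntireTHCertLetters
open Summit.NavierStokesRegularity.NavierStokesRegularity.Theorems.PoloidalWindowDoorLrcModEntireTHCert

variable {E : Type*} [NormedAddCommGroup E] [NormedSpace ℝ E] {n : ℕ}

/-! ### Extending a local datum by a certified law (chunking) -/

/-- A fast masked certificate whose `k`-th law is syntactically `T` proves that `T` vanishes on `U`. [folklore] -/
theorem ev_eq_zero_of_certCheckF {U : Set E} (hU : IsOpen U) {g : E → EuclideanSpace ℝ (Fin n)} {v : ℕ → E}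
    {S : ℕ → ℕ → QMvPoly} {M : ℕ → ℕ → Bool} (hg : ∀ x ∈ U, DifferentiableAt ℝ g x)
    (hS : ∀ j, ∀ i : Fin n, M j i = true → ∀ x ∈ U, fderiv ℝ (fun y => g y i) x (v j) = ev n (S j i) (g x))
    {hyps : List QMvPoly} (hhyps : ∀ L ∈ hyps, ∀ x ∈ U, ev n L (g x) = 0)
    {cert : List (List (QMvPoly × ℕ × List ℕ))} {k : ℕ} {T : QMvPoly} (hcheck : certCheckF n S M hyps cert k T = true) :
    ∀ x ∈ U, ev n T (g x) = 0 := by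
  intro x hx
  simp only [certCheckF] at hcheck
  cases hd : deriveF n S M hyps cert with
  | none => simp [hd] at hcheck
  | some laws =>
    simp only [hd, decide_eq_true_eq] at hcheck
    have hlaw : ev n (laws.getD k []) (g x) = 0 := by
      rw [List.getD_eq_getElem?_getD]
      cases h : laws[k]? with
      | none => simp
      | some L => simpa using ev_deriveF_eq_zero hU hg hS cert hyps hhyps laws hd L (List.mem_of_getElem? h) x hx
    have hdiff : ev n (laws.getD k [] ++ QMvPoly.smul (-1) T) (g x) = 0 := by
      rw [← ev_normalize, hcheck, ev_nil]
    rw [ev_append, ev_smul, hlaw] at hdiff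
    simpa using hdiff

/-- **CHUNKING**: a certified law may be appended to the hypotheses of a local datum. [folklore] -/
theorem localDatum_extend {S : ℕ → ℕ → QMvPoly} {M : ℕ → ℕ → Bool} {v : ℕ → E} {hyps pins : List QMvPoly}
    (hdat : LocalDatum n S M v hyps pins) {cert : List (List (QMvPoly × ℕ × List ℕ))} {k : ℕ} {T : QMvPoly}
    (hcheck : certCheckF n S M hyps cert k T = true) : LocalDatum n S M v (hyps ++ [T]) pins := by
  obtain ⟨U, p₀, g, hU, hp₀, hg, hS, hhyps, hpins⟩ := hdat
  refine ⟨U, p₀, g, hU, hp₀, hg, hS, ?_, hpins⟩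
  intro L hL x hx
  rcases List.mem_append.1 hL with h | h
  · exact hhyps L h x hx
  · rw [List.mem_singleton.1 h]
    exact ev_eq_zero_of_certCheckF hU hg hS hhyps hcheck x hx

/-! ### The stub's data as a local datum -/

/-- **The data of `stub_localTHEmpty` IS a local datum** for the base laws and pins along any letter list containing the base letters. [folklore] -/
theorem thLocalDatum (L : List THLetter) (hL : lettersOK L = true)
    {u : ℝ → EuclideanSpace ℝ (Fin 3) → EuclideanSpace ℝ (Fin 3)} {μ A : ℝ → ℝ → ℝ}
    {U : Set (ℝ × EuclideanSpace ℝ (Fin 3))} {p₀ : ℝ × EuclideanSpace ℝ (Fin 3)} (hU : IsOpen U) (hp₀ : p₀ ∈ U)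
    (hu : AnalyticOnNhd ℝ (Function.uncurry u) U)
    (hμ : ∀ p ∈ U, AnalyticAt ℝ (Function.uncurry μ) (p.1, p.2 2)) (hA : ∀ p ∈ U, AnalyticAt ℝ (Function.uncurry A) (p.1, p.2 2))
    (hpol : ∀ p ∈ U, fderiv ℝ (u p.1) p.2 (EuclideanSpace.single 0 1) 1 = fderiv ℝ (u p.1) p.2 (EuclideanSpace.single 1 1) 0)
    (hdiv : ∀ p ∈ U, fderiv ℝ (u p.1) p.2 (EuclideanSpace.single 0 1) 0 + fderiv ℝ (u p.1) p.2 (EuclideanSpace.single 1 1) 1 +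
      fderiv ℝ (u p.1) p.2 (EuclideanSpace.single 2 1) 2 = 0)
    (hsh : ∀ p ∈ U, ∀ b : Fin 3, b ≠ 2 →
      fderiv ℝ (u p.1) p.2 (EuclideanSpace.single 2 1) b = μ p.1 (p.2 2) * fderiv ℝ (u p.1) p.2 (EuclideanSpace.single b 1) 2)
    (hE : ∀ p ∈ U,
      (1 - μ p.1 (p.2 2)) *
          (deriv (fun s => u s p.2 2) p.1 + fderiv ℝ (fun y => u p.1 y 2) p.2 (u p.1 p.2) - Δ (fun y => u p.1 y 2) p.2) =
        A p.1 (p.2 2) + (deriv (fun s => μ s (p.2 2)) p.1 - deriv (deriv (μ p.1)) (p.2 2)) * u p.1 p.2 2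
          + deriv (μ p.1) (p.2 2) / 2 * u p.1 p.2 2 ^ 2 - 2 * deriv (μ p.1) (p.2 2) * fderiv ℝ (u p.1) p.2 (EuclideanSpace.single 2 1) 2)
    (htw : fderiv ℝ (fun y => fderiv ℝ (u p₀.1) y (EuclideanSpace.single 2 1) 2) p₀.2 (EuclideanSpace.single 0 1) *
            fderiv ℝ (u p₀.1) p₀.2 (EuclideanSpace.single 1 1) 2 -
          fderiv ℝ (fun y => fderiv ℝ (u p₀.1) y (EuclideanSpace.single 2 1) 2) p₀.2 (EuclideanSpace.single 1 1) *
            fderiv ℝ (u p₀.1) p₀.2 (EuclideanSpace.single 0 1) 2 ≠ 0)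
    (hm0 : μ p₀.1 (p₀.2 2) ≠ 0) (hm1 : μ p₀.1 (p₀.2 2) ≠ 1) (hmz : deriv (μ p₀.1) (p₀.2 2) ≠ 0) :
    LocalDatum L.length (tableOf L) (maskOf L) dirVec (thHyps L) (thPins L) :=
  ⟨U, p₀, jetMapOf L u μ A, hU, hp₀, fun _ hp => differentiableAt_jetMapOf hu hμ hA hp,
    fun j i hi _ hp => tables_jetMapOf hU hu hμ hA j i hi hp,
    thHyps_vanish hL hU hu hμ hpol hdiv hsh hE, thPins_ne_zero hL hU hu hμ hp₀ htw hm0 hm1 hmz⟩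

/-! ### The fast one-shot closer -/

/-- **`stub_localTHEmpty` from a tree checked by the FAST checker**, VERBATIM the registered stub. [folklore] -/
theorem stub_localTHEmpty_of_checkTreeF (L : List THLetter) (hL : lettersOK L = true) (t : CertTree)
    (ht : checkTreeF L.length (tableOf L) (maskOf L) (thHyps L) (thPins L) t = true) :
    ∀ (u : ℝ → EuclideanSpace ℝ (Fin 3) → EuclideanSpace ℝ (Fin 3)) (μ A : ℝ → ℝ → ℝ)
      (U : Set (ℝ × EuclideanSpace ℝ (Fin 3))) (p₀ : ℝ × EuclideanSpace ℝ (Fin 3)),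
      IsOpen U → p₀ ∈ U →
      AnalyticOnNhd ℝ (Function.uncurry u) U →
      (∀ p ∈ U, AnalyticAt ℝ (Function.uncurry μ) (p.1, p.2 2)) →
      (∀ p ∈ U, AnalyticAt ℝ (Function.uncurry A) (p.1, p.2 2)) →
      (∀ p ∈ U, fderiv ℝ (u p.1) p.2 (EuclideanSpace.single 0 1) 1 = fderiv ℝ (u p.1) p.2 (EuclideanSpace.single 1 1) 0) →
      (∀ p ∈ U, fderiv ℝ (u p.1) p.2 (EuclideanSpace.single 0 1) 0 + fderiv ℝ (u p.1) p.2 (EuclideanSpace.single 1 1) 1 +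
        fderiv ℝ (u p.1) p.2 (EuclideanSpace.single 2 1) 2 = 0) →
      (∀ p ∈ U, ∀ b : Fin 3, b ≠ 2 →
        fderiv ℝ (u p.1) p.2 (EuclideanSpace.single 2 1) b =
          μ p.1 (p.2 2) * fderiv ℝ (u p.1) p.2 (EuclideanSpace.single b 1) 2) →
      (∀ p ∈ U,
        (1 - μ p.1 (p.2 2)) *
            (deriv (fun s => u s p.2 2) p.1 + fderiv ℝ (fun y => u p.1 y 2) p.2 (u p.1 p.2)
              - Δ (fun y => u p.1 y 2) p.2) =
          A p.1 (p.2 2) + (deriv (fun s => μ s (p.2 2)) p.1 - deriv (deriv (μ p.1)) (p.2 2)) * u p.1 p.2 2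
            + deriv (μ p.1) (p.2 2) / 2 * u p.1 p.2 2 ^ 2
            - 2 * deriv (μ p.1) (p.2 2) * fderiv ℝ (u p.1) p.2 (EuclideanSpace.single 2 1) 2) →
      fderiv ℝ (fun y => fderiv ℝ (u p₀.1) y (EuclideanSpace.single 2 1) 2) p₀.2 (EuclideanSpace.single 0 1) *
            fderiv ℝ (u p₀.1) p₀.2 (EuclideanSpace.single 1 1) 2 -
          fderiv ℝ (fun y => fderiv ℝ (u p₀.1) y (EuclideanSpace.single 2 1) 2) p₀.2 (EuclideanSpace.single 1 1) *
            fderiv ℝ (u p₀.1) p₀.2 (EuclideanSpace.single 0 1) 2 ≠ 0 →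
      μ p₀.1 (p₀.2 2) ≠ 0 → μ p₀.1 (p₀.2 2) ≠ 1 → deriv (μ p₀.1) (p₀.2 2) ≠ 0 → False := by
  intro u μ A U p₀ hU hp₀ hu hμ hA hpol hdiv hsh hE htw hm0 hm1 hmz
  exact not_localDatum_of_checkTreeF (v := dirVec) t (thHyps L) (thPins L) ht
    (thLocalDatum L hL hU hp₀ hu hμ hA hpol hdiv hsh hE htw hm0 hm1 hmz)

/-- **The generic final step of a CHUNKED certificate**: a fast tree over extended hypotheses `thHyps L ++ Ts` refutes the extended
datum (obtained from `thLocalDatum` by repeated `localDatum_extend`). [folklore] -/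
theorem false_of_checkTreeF_extended (L : List THLetter) (Ts : List QMvPoly) (t : CertTree)
    (ht : checkTreeF L.length (tableOf L) (maskOf L) (thHyps L ++ Ts) (thPins L) t = true)
    (hdat : LocalDatum (E := ℝ × EuclideanSpace ℝ (Fin 3)) L.length (tableOf L) (maskOf L) dirVec (thHyps L ++ Ts) (thPins L)) :
    False :=
  not_localDatum_of_checkTreeF t _ _ ht hdat

end Summit.NavierStokesRegularity.NavierStokesRegularity.Theorems.PoloidalWindowDoorLrcModEntireTHCertFast

end
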